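import Summits.QuantumAdvantage.QuantumAdvantage.Theorems.CharDialPrefixUnread
import Summits.QuantumAdvantage.QuantumAdvantage.Theorems.CharDialReversal
import HarnessLib
import Literature.GroupTheory.PermutationGroups.PrimitiveGroupOrderExponentialBounds

/-!
# The prefix face of `WalkHardFJLinOdd`, part A: one-read sets, the dial from a finite obstruction, the parity principle,
per-cut evenness (decomp-qadv lens-6 g16, tree part 29A)

Setting (landed `JLinPeel` API): strategies `D : JLinData p n` of the `n+1` cuts, `y_g(u) = h_g(u|_{J_g}, ⟨a_g,u⟩)`, junta
`|J_g| ≤ log₂ n`, here with PREFIX-COUNTER forms `a_g = t_g·𝟙_{[0,g)}`; the odd-`n` parity⊕mod-3 u-walk relation `ringWinU c`.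
This part proves the four qualitative laws of the closing argument (part 29 = `CharDialPrefixFace` concludes):

* `PrefixFace.oneReadRich` — for `n ≥ 2^(6K+10)` every `log₂ n`-junta schedule has a set `S` of `K` positions with
  `|J_g ∩ S| ≤ 1` for every cut (greedy independent set in the «read by a common cut» graph);
* `PrefixFace.winBound_of_noPerfect` — THE DIAL: if every prefix-counter junta strategy loses SOME point of EVERY fibre
  `{x = b off S}` over every such `S` with `|S| = K₀`, then the strategies win on at most `(1 − 2^{−K₀})·2ⁿ` inputs for
  `n ≥ 2^(6K₀+10)` (fibre counting, `sum_card_subcube`);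
* `PrefixFace.exists_loser_of_even_cuts` — THE PARITY PRINCIPLE: on a family of ODD size on which every cut fires-live an
  EVEN number of times some member loses (the win bit is the mod-2 count of live firings);
* `PrefixFace.even_fired_live` — LINEARITY: on a one-read subcube the fire bit of a prefix-counter cut is a function of
  (the one free bit it reads, the free prefix count mod `p`), so CLASS BALANCE of the family gives even live firings — the
  tables `h_g` play no role.
Kernel-closed, no `decide`; imports parts `CharDialPrefixUnread` (`form_prefix`) and `CharDialReversal`.
-/

set_option linter.dupNamespace false
set_option autoImplicit false

namespace Summit.QuantumAdvantage.AdviceFreeQNC0.JLinPeel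

open Finset AffBells22

namespace PrefixFace

/-! ### ONE-READ FREE SETS -/

section OneReadSets

/-- greedy independent set for a symmetric relation: independent AND dominating. -/
theorem greedy_indep {α : Type*} [DecidableEq α] (R : α → α → Prop) (hR : ∀ a b, R a b → R b a) (T : Finset α) :
    ∃ S ⊆ T, (∀ s ∈ S, ∀ s' ∈ S, s ≠ s' → ¬ R s s') ∧ ∀ t ∈ T, ∃ s ∈ S, s = t ∨ R s t := by
  classical
  induction' T using Finset.strongInduction with T ih
  rcases T.eq_empty_or_nonempty with hT | ⟨t, ht⟩
  · exact ⟨∅, by simp [hT]⟩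
  · set T' := T.filter fun x => ¬ R t x ∧ x ≠ t with hT'
    have hsub : T' ⊂ T := by
      refine ⟨filter_subset _ _, fun h => ?_⟩
      have := (mem_filter.mp (h ht)).2.2
      exact this rfl
    obtain ⟨S', hS'T', hind, hcov⟩ := ih T' hsub
    refine ⟨insert t S', insert_subset ht (hS'T'.trans (filter_subset _ _)), ?_, ?_⟩
    · intro s hs s' hs' hne
      rw [mem_insert] at hs hs'
      rcases hs with rfl | hs <;> rcases hs' with rfl | hs'
      · exact absurd rfl hne
      · exact (mem_filter.mp (hS'T' hs')).2.1
      · exact fun h => (mem_filter.mp (hS'T' hs)).2.1 (hR _ _ h)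
      · exact hind s hs s' hs' hne
    · intro x hx
      by_cases h : R t x ∨ x = t
      · refine ⟨t, mem_insert_self _ _, ?_⟩
        rcases h with h | rfl
        · exact Or.inr h
        · exact Or.inl rfl
      · push Not at h
        obtain ⟨s, hs, h'⟩ := hcov x (mem_filter.mpr ⟨hx, h.1, h.2⟩)
        exact ⟨s, mem_insert_of_mem hs, h'⟩

variable {n : ℕ}

/-- double counting: `Σ_t #readers(t) = Σ_g |J g|`. -/
theorem sum_card_readers (J : Fin (n + 1) → Finset (Fin n)) :
    ∑ t : Fin n, (univ.filter fun g : Fin (n + 1) => t ∈ J g).card = ∑ g : Fin (n + 1), (J g).card := by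
  classical
  simp_rw [card_filter]
  rw [sum_comm]
  refine sum_congr rfl fun g _ => ?_
  rw [← card_filter]
  congr 1
  ext t
  simp

/-- **one-read free sets**: for read data with `≤ k` reads per cut and any threshold `M`, there are a set `S` of positions no two of which are
read by a common cut and a set `H` of «hub» positions (read by `> M` cuts) with `|H|·(M+1) ≤ (n+1)·k` and `n ≤ |H| + (M·k+1)·|S|`. -/
theorem exists_oneRead_set (J : Fin (n + 1) → Finset (Fin n)) (k M : ℕ) (hJ : ∀ g, (J g).card ≤ k) :
    ∃ S H : Finset (Fin n), (∀ g, (J g ∩ S).card ≤ 1) ∧ H.card * (M + 1) ≤ (n + 1) * k ∧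
      n ≤ H.card + (M * k + 1) * S.card := by
  classical
  set rd : Fin n → Finset (Fin (n + 1)) := fun t => univ.filter fun g => t ∈ J g with hrd
  set H := univ.filter fun t : Fin n => M < (rd t).card with hH
  set T := univ.filter fun t : Fin n => (rd t).card ≤ M with hT
  let R : Fin n → Fin n → Prop := fun s s' => ∃ g, s ∈ J g ∧ s' ∈ J g
  obtain ⟨S, hST, hind, hcov⟩ := greedy_indep R (fun a b ⟨g, ha, hb⟩ => ⟨g, hb, ha⟩) T
  refine ⟨S, H, ?_, ?_, ?_⟩
  · intro g
    refine card_le_one.mpr fun a ha b hb => ?_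
    by_contra hne
    rw [mem_inter] at ha hb
    exact hind a ha.2 b hb.2 hne ⟨g, ha.1, hb.1⟩
  · calc H.card * (M + 1) = H.card • (M + 1) := (smul_eq_mul _ _).symm
      _ ≤ ∑ t ∈ H, (rd t).card := card_nsmul_le_sum _ _ _ fun t ht => (mem_filter.mp ht).2
      _ ≤ ∑ t, (rd t).card := sum_le_sum_of_subset_of_nonneg (subset_univ _) fun _ _ _ => Nat.zero_le _
      _ = ∑ g, (J g).card := sum_card_readers J
      _ ≤ ∑ _g : Fin (n + 1), k := sum_le_sum fun g _ => hJ g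
      _ = (n + 1) * k := by simp
  · have hTH : T.card + H.card = n := by
      have := card_filter_add_card_filter_not (s := (univ : Finset (Fin n))) (fun t => (rd t).card ≤ M)
      simpa only [not_le, card_univ, Fintype.card_fin] using this
    have hTS : T.card ≤ (M * k + 1) * S.card := by
      have hcovT : T ⊆ S.biUnion fun s => insert s (univ.filter fun t => R s t) := by
        intro t ht
        obtain ⟨s, hs, h⟩ := hcov t ht
        rw [mem_biUnion]
        refine ⟨s, hs, ?_⟩
        rcases h with rfl | h
        · exact mem_insert_self _ _
        · exact mem_insert_of_mem (mem_filter.mpr ⟨mem_univ _, h⟩)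
      refine (card_le_card hcovT).trans (card_biUnion_le.trans ?_)
      calc ∑ s ∈ S, (insert s (univ.filter fun t => R s t)).card ≤ ∑ _s ∈ S, (M * k + 1) :=
            sum_le_sum fun s hs => by
              have hsT : (rd s).card ≤ M := (mem_filter.mp (hST hs)).2
              have hsub : (univ.filter fun t => R s t) ⊆ (rd s).biUnion J := by
                intro t ht
                obtain ⟨g, hg1, hg2⟩ := (mem_filter.mp ht).2
                exact mem_biUnion.mpr ⟨g, mem_filter.mpr ⟨mem_univ _, hg1⟩, hg2⟩
              have h1 : (univ.filter fun t => R s t).card ≤ (rd s).card * k :=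
                (card_le_card hsub).trans (card_biUnion_le.trans
                  (calc ∑ g ∈ rd s, (J g).card ≤ ∑ _g ∈ rd s, k := sum_le_sum fun g _ => hJ g
                    _ = (rd s).card * k := by rw [sum_const, smul_eq_mul]))
              have h2 : (rd s).card * k ≤ M * k := Nat.mul_le_mul_right _ hsT
              exact (card_insert_le _ _).trans (by omega)
        _ = (M * k + 1) * S.card := by rw [sum_const, smul_eq_mul, mul_comm]
    omega

/-- **ONE-READ RICHNESS**: every `log₂ n`-junta read structure on `n ≥ 2^(6K+10)` positions has `K` positions no two of which are
read by a common cut (every cut reads at most one of them). -/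
theorem oneReadRich (K : ℕ) :
    ∃ n₀ : ℕ, ∀ n ≥ n₀, ∀ J : Fin (n + 1) → Finset (Fin n), (∀ g, (J g).card ≤ Nat.log 2 n) →
      ∃ S : Finset (Fin n), (∀ g, (J g ∩ S).card ≤ 1) ∧ K ≤ S.card := by
  classical
  rcases Nat.eq_zero_or_pos K with rfl | hK1
  · exact ⟨0, fun n _ J _ => ⟨∅, fun g => by simp, le_rfl⟩⟩
  obtain ⟨K', rfl⟩ : ∃ K', K = K' + 1 := ⟨K - 1, by omega⟩
  refine ⟨2 ^ (6 * (K' + 1) + 10), fun n hn J hJ => ?_⟩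
  set L := Nat.log 2 n with hL
  have hLm : 6 * (K' + 1) + 10 ≤ L := Nat.le_log_of_pow_le one_lt_two hn
  have hn0 : n ≠ 0 := by have := Nat.one_le_two_pow (n := 6 * (K' + 1) + 10); omega
  have h2L : 2 ^ L ≤ n := Nat.pow_log_le_self 2 hn0
  have hL3 : L ^ 3 ≤ 2 ^ L := Literature.GroupTheory.PermutationGroups.cube_le_two_pow (by omega)
  obtain ⟨S, H, hS, hH, hT⟩ := exists_oneRead_set J L (2 * L) hJ
  refine ⟨S, hS, ?_⟩
  by_contra hK
  push Not at hK
  have hSK : S.card ≤ K' := by omega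
  have hL0 : 0 < L := by omega
  have hH2 : 2 * H.card ≤ n + 1 := by
    have h' : 2 * H.card * L ≤ (n + 1) * L := by nlinarith
    exact Nat.le_of_mul_le_mul_right h' hL0
  have hmono : (2 * L * L + 1) * S.card ≤ (2 * L * L + 1) * K' := Nat.mul_le_mul_left _ hSK
  have hn1 : n ≤ 1 + (4 * L * L + 2) * K' := by nlinarith
  have hLL : 1 ≤ L * L := by nlinarith
  have hA : (6 * K' + 16) * (L * L) ≤ L * (L * L) := Nat.mul_le_mul_right _ (by omega)
  have hB : K' * 1 ≤ K' * (L * L) := Nat.mul_le_mul_left _ hLL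
  have h6 : (4 * L * L + 2) * K' + 1 < L ^ 3 := by nlinarith [hA, hB, hLL]
  omega

end OneReadSets

/-! ### THE DIAL FROM A FINITE OBSTRUCTION: one losing point on every `K₀`-free-bit one-read subcube ⟹ a `θ < 1` bound -/

section Dial

variable {p : ℕ}

/-- a property of inputs implied by agreement with `u₀` on `S` holds on at least `2^(n-|S|)` inputs. -/
theorem card_fibre_le {n : ℕ} (S : Finset (Fin n)) (Q : (Fin n → Bool) → Prop) [DecidablePred Q] (u₀ : Fin n → Bool)
    (hQ : ∀ u : Fin n → Bool, (∀ i ∈ S, u i = u₀ i) → Q u) : 2 ^ (n - S.card) ≤ (univ.filter Q).card := by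
  classical
  set A : Finset (Fin n → Bool) := Fintype.piFinset fun i => if i ∈ S then ({u₀ i} : Finset Bool) else univ with hA
  have hcard : A.card = 2 ^ (n - S.card) := by
    rw [hA, Fintype.card_piFinset]
    have hc : ∀ i : Fin n, ((if i ∈ S then ({u₀ i} : Finset Bool) else univ).card) = if i ∈ S then 1 else 2 := fun i => by
      split_ifs <;> simp
    simp_rw [hc]
    rw [Finset.prod_ite, Finset.prod_const_one, one_mul, Finset.prod_const]
    congr 1
    have : (univ.filter fun i : Fin n => ¬ i ∈ S) = univ \ S := by ext i; simp
    rw [this, card_univ_sdiff, Fintype.card_fin]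
  have hsub : A ⊆ univ.filter Q := by
    intro u hu
    rw [hA, Fintype.mem_piFinset] at hu
    refine mem_filter.mpr ⟨mem_univ _, hQ u fun i hi => ?_⟩
    have := hu i
    rw [if_pos hi, mem_singleton] at this
    exact this
  exact hcard ▸ card_le_card hsub

/-- **THE DIAL** (one-read kernel, integral form): «no perfect one-read play at `K₀` free bits» ⟹ prefix-counter `log₂ n`-junta
strategies win on at most `θ·2ⁿ` inputs, `θ = 1 − 2^{−K₀}`, `n ≥ 2^(6K₀+10)` (`oneReadRich K₀`, a sub-set of exactly `K₀` of the
one-read positions, fibre counting). -/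
theorem winBound_of_noPerfect {K₀ : ℕ}
    (h : ∀ (n c : ℕ) (D : JLinData p n), (∀ g, ∃ t : ZMod p, D.a g = fun i => if i.val < g.val then t else 0) →
      ∀ S : Finset (Fin n), (∀ g, (D.J g ∩ S).card ≤ 1) → S.card = K₀ → ∀ b : Fin n → Bool,
        ∃ u : Fin n → Bool, ringWinU c D.strat (subcubeMerge (univ \ S) b u) = false) :
    ∃ θ : ℝ, θ < 1 ∧ ∃ n₀ : ℕ, ∀ n ≥ n₀, ∀ (c : ℕ) (D : JLinData p n),
      (∀ g, (D.J g).card ≤ Nat.log 2 n) →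
      (∀ g, ∃ t : ZMod p, D.a g = fun i => if i.val < g.val then t else 0) →
      (winCount c D.strat : ℝ) ≤ θ * (2 : ℝ) ^ n := by
  classical
  obtain ⟨n₀, hn₀⟩ := oneReadRich K₀
  refine ⟨1 - (1 / 2) ^ K₀, by have := pow_pos (by norm_num : (0:ℝ) < 1 / 2) K₀; linarith, n₀, fun n hn c D hJ hpre => ?_⟩
  obtain ⟨S₁, hS₁, hKS₁⟩ := hn₀ n hn D.J hJ
  obtain ⟨S, hSS₁, hSK⟩ := Finset.exists_subset_card_eq hKS₁
  have hS : ∀ g, (D.J g ∩ S).card ≤ 1 := fun g =>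
    (card_le_card (inter_subset_inter_left (hSS₁))).trans (hS₁ g)
  set W : Finset (Fin n) := univ \ S with hW
  have hKn : K₀ ≤ n := by have := card_le_univ S; simpa [hSK] using this
  -- on every subcube, at least `2^(n-K₀)` of the `u` are losers
  have hb : ∀ b : Fin n → Bool,
      (univ.filter fun u : Fin n → Bool => ringWinU c D.strat (subcubeMerge W b u) = true).card + 2 ^ (n - K₀) ≤ 2 ^ n := by
    intro b
    obtain ⟨u₀, hu₀⟩ := h n c D hpre S hS hSK b
    have hlose := card_fibre_le S (fun u : Fin n → Bool => ¬ ringWinU c D.strat (subcubeMerge W b u) = true) u₀ (by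
      intro u hu
      have e : subcubeMerge W b u = subcubeMerge W b u₀ := by
        funext i
        by_cases hi : i ∈ S
        · have hiW : i ∉ W := by simp [hW, hi]
          simp [subcubeMerge, hiW, hu i hi]
        · have hiW : i ∈ W := by simp [hW, hi]
          simp [subcubeMerge, hiW]
      rw [e, hu₀]; simp)
    rw [hSK] at hlose
    have htot := Finset.card_filter_add_card_filter_not (s := (univ : Finset (Fin n → Bool)))
      (fun u : Fin n → Bool => ringWinU c D.strat (subcubeMerge W b u) = true)
    rw [card_univ, Fintype.card_fun, Fintype.card_bool, Fintype.card_fin] at htot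
    omega
  have hsum := sum_card_subcube W (fun u : Fin n → Bool => ringWinU c D.strat u = true)
  have hN : winCount c D.strat + 2 ^ (n - K₀) ≤ 2 ^ n := by
    have h1 : 2 ^ n * (winCount c D.strat + 2 ^ (n - K₀)) ≤ 2 ^ n * 2 ^ n := by
      calc 2 ^ n * (winCount c D.strat + 2 ^ (n - K₀))
          = (∑ b : Fin n → Bool, (univ.filter fun u : Fin n → Bool => ringWinU c D.strat (subcubeMerge W b u) = true).card)
              + ∑ _b : Fin n → Bool, 2 ^ (n - K₀) := by
            rw [mul_add]; unfold winCount; rw [← hsum]; simp [sum_const]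
        _ = ∑ b : Fin n → Bool, ((univ.filter fun u : Fin n → Bool => ringWinU c D.strat (subcubeMerge W b u) = true).card
              + 2 ^ (n - K₀)) := (sum_add_distrib).symm
        _ ≤ ∑ _b : Fin n → Bool, 2 ^ n := sum_le_sum fun b _ => hb b
        _ = 2 ^ n * 2 ^ n := by simp [sum_const]
    exact Nat.le_of_mul_le_mul_left h1 (by positivity)
  -- real form
  have h2 : (2 : ℝ) ^ (n - K₀) = (2 : ℝ) ^ n * (1 / 2) ^ K₀ := by
    have : (2 : ℝ) ^ (n - K₀) * 2 ^ K₀ = 2 ^ n := by rw [← pow_add, Nat.sub_add_cancel hKn]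
    rw [← this, mul_assoc, ← mul_pow]; norm_num
  have hNR : (winCount c D.strat : ℝ) + (2 : ℝ) ^ (n - K₀) ≤ (2 : ℝ) ^ n := by exact_mod_cast hN
  rw [h2] at hNR
  linarith

end Dial

/-! ### THE PARITY PRINCIPLE: an odd family on which every cut fires live an even number of times contains a loser -/

section Parity

variable {n : ℕ}

/-- **parity principle**: if a family of inputs indexed by a type of ODD size is such that every cut `g` fires live
(`y g x ∧ label ≠ 0`) on an EVEN number of members, then some member loses the walk game (`T(x) = Σ_g [fire ∧ live] mod 2`
summed over the family is `0 ≠ |family|`). -/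
theorem exists_loser_of_even_cuts {ι : Type*} [Fintype ι] (c : ℕ) (y : Fin (n + 1) → (Fin n → Bool) → Bool)
    (x : ι → (Fin n → Bool)) (hodd : Odd (Fintype.card ι))
    (heven : ∀ g : Fin (n + 1),
      Even ((univ.filter fun i : ι => y g (x i) = true ∧ (c + g.val + walkExp (x i) g.val) % 3 ≠ 0).card)) :
    ∃ i : ι, ringWinU c y (x i) = false := by
  classical
  by_contra hcon
  push Not at hcon
  set F : Fin (n + 1) → ι → Prop := fun g i => y g (x i) = true ∧ (c + g.val + walkExp (x i) g.val) % 3 ≠ 0 with hF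
  have hwin : ∀ i, Odd ((univ.filter fun g => F g i).card) := by
    intro i
    have := hcon i
    unfold ringWinU at this
    rw [Nat.odd_iff]
    simpa [hF] using this
  have hdc : (∑ i : ι, (univ.filter fun g => F g i).card) = ∑ g : Fin (n + 1), (univ.filter fun i => F g i).card := by
    simp_rw [card_filter]
    exact sum_comm
  have h1 : ((∑ i : ι, (univ.filter fun g => F g i).card : ℕ) : ZMod 2) = 1 := by
    rw [Nat.cast_sum, sum_congr rfl fun i _ => (ZMod.natCast_eq_one_iff_odd.mpr (hwin i))]
    rw [sum_const, card_univ, nsmul_eq_mul, mul_one]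
    exact ZMod.natCast_eq_one_iff_odd.mpr hodd
  have h0 : ((∑ g : Fin (n + 1), (univ.filter fun i => F g i).card : ℕ) : ZMod 2) = 0 := by
    rw [Nat.cast_sum]
    exact sum_eq_zero fun g _ => ZMod.natCast_eq_zero_iff_even.mpr (heven g)
  rw [hdc, h0] at h1
  exact zero_ne_one h1

end Parity

/-! ### LINEARITY: on a one-read subcube a prefix-counter cut fires live an even number of times on any CLASS-BALANCED family -/

section CutEven

variable {p n : ℕ}

/-- **per-cut evenness.**  `D` prefix-counter at cut `g`, reading at most the one free position `i₀` of `S`; a family `x` of points of the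
subcube `{· = b off S}` whose classes `{x i₀ = v, W_{<g} ≡ w (mod p)}` all avoid every residue `e` of the walk exponent an even number of
times.  Then cut `g` fires live on an even number of members. -/
theorem even_fired_live {ι : Type*} [Fintype ι] (hp : 0 < p) (D : JLinData p n) (g : Fin (n + 1)) (t : ZMod p)
    (hpre : D.a g = fun i => if i.val < g.val then t else 0)
    (S : Finset (Fin n)) (i₀ : Fin n) (hJ : D.J g ∩ S ⊆ {i₀}) (b : Fin n → Bool)
    (x : ι → (Fin n → Bool)) (hx : ∀ i, ∀ j, j ∉ S → x i j = b j) (c : ℕ)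
    (hbal : ∀ (v : Bool) (w e : ℕ), e < 3 →
      Even ((univ.filter fun i => x i i₀ = v ∧ wtPrefix (x i) g.val % p = w ∧ walkExp (x i) g.val % 3 ≠ e).card)) :
    Even ((univ.filter fun i => D.strat g (x i) = true ∧ (c + g.val + walkExp (x i) g.val) % 3 ≠ 0).card) := by
  classical
  set xref : Bool → (Fin n → Bool) := fun v j => if j = i₀ then v else b j with hxref
  set F : Bool × ℕ → Bool := fun k => D.h g (xref k.1) (t * (k.2 : ZMod p)) with hF
  set key : ι → Bool × ℕ := fun i => (x i i₀, wtPrefix (x i) g.val % p) with hkey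
  set e : ℕ := (2 * (c + g.val)) % 3 with he
  have he3 : e < 3 := Nat.mod_lt _ (by norm_num)
  have hfire : ∀ i, D.strat g (x i) = F (key i) := by
    intro i
    show D.h g (x i) (D.form g (x i)) = D.h g (xref (x i i₀)) (t * ((wtPrefix (x i) g.val % p : ℕ) : ZMod p))
    rw [form_prefix D hpre, ZMod.natCast_mod]
    refine D.hJ g (x i) (xref (x i i₀)) (fun j hj => ?_) _
    by_cases hji : j = i₀
    · subst hji; simp [hxref]
    · have hjS : j ∉ S := fun hjS => hji (mem_singleton.mp (hJ (mem_inter.mpr ⟨hj, hjS⟩)))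
      simp [hxref, hji, hx i j hjS]
  have hlive : ∀ u : Fin n → Bool, ((c + g.val + walkExp u g.val) % 3 ≠ 0 ↔ walkExp u g.val % 3 ≠ e) := by
    intro u; rw [he]; omega
  have hset : (univ.filter fun i => D.strat g (x i) = true ∧ (c + g.val + walkExp (x i) g.val) % 3 ≠ 0)
      = univ.filter fun i => F (key i) = true ∧ walkExp (x i) g.val % 3 ≠ e := by
    ext i; simp only [mem_filter, mem_univ, true_and, hfire i, hlive (x i)]
  rw [hset]
  set K : Finset (Bool × ℕ) := (univ ×ˢ range p).filter fun k => F k = true with hK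
  rw [card_eq_sum_card_fiberwise (f := key) (t := K) (fun i hi =>
    mem_filter.mpr ⟨mem_product.mpr ⟨mem_univ _, mem_range.mpr (Nat.mod_lt _ hp)⟩, (mem_filter.mp hi).2.1⟩)]
  refine even_sum _ fun k hk => ?_
  obtain ⟨v, w⟩ := k
  have hFk : F (v, w) = true := (mem_filter.mp hk).2
  have hAB : ((univ.filter fun i => F (key i) = true ∧ walkExp (x i) g.val % 3 ≠ e).filter fun i => key i = (v, w))
      = univ.filter fun i => x i i₀ = v ∧ wtPrefix (x i) g.val % p = w ∧ walkExp (x i) g.val % 3 ≠ e := by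
    ext i
    simp only [mem_filter, mem_univ, true_and, hkey, Prod.mk.injEq]
    constructor
    · rintro ⟨⟨_, hQ⟩, h1, h2⟩; exact ⟨h1, h2, hQ⟩
    · rintro ⟨h1, h2, hQ⟩; exact ⟨⟨by rw [h1, h2]; exact hFk, hQ⟩, h1, h2⟩
  rw [hAB]
  exact hbal v w e he3

end CutEven

end PrefixFace

end Summit.QuantumAdvantage.AdviceFreeQNC0.JLinPeel
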